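import Literature.Probability.LatticeModels.DirichletGreenFunction
import HarnessLib

/-!
# Invariance of the Dirichlet Green function and the Poisson kernel under lattice symmetries

Topic `Literature/Probability/LatticeModels` (discrete potential theory on `ℤ^d`; companion of
`DirichletGreenFunction.lean`). A **lattice symmetry** is a bijection `σ` of `ℤ^d` preserving
nearest-neighbour adjacency (translations `Site.shift v`, and for `d = 2` the reflections and the
quarter turns). The killed walk is equivariant under `σ`, i.e.

* `latticeLaplacianZd_comp_equiv` — `Δ (f ∘ σ) (x) = Δ f (σ x)`;
* `dirichletGreen_map_equiv` — `G_{σΛ}(σx, σy) = G_Λ(x, y)` (uniqueness for the Poisson problem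
  `-Δ G_Λ(x, ·) = δ_x`, zero outside `Λ`);
* `poissonKernel_map_equiv` — `H_{σΛ}(σx, σz) = H_Λ(x, z)`;
* the symmetries of `ℤ²` used downstream: `Site.shift v` (translations), `reflectFst`
  (`(a, b) ↦ (-a, b)`), `reflectSnd`, `swapCoords` (`(a, b) ↦ (b, a)`), with their adjacency
  invariance, and the translation forms `dirichletGreen_shift`, `poissonKernel_shift`
  (membership in a translate is `Finset.mem_map_equiv` with `Site.shift_symm_apply`).

Everything here is proved, `[folklore]` (Lawler 1991, §1.4–1.5: the killed walk of `A + v` is the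
translate of that of `A`).

## References

* G. F. Lawler, *Intersections of Random Walks* (1991), §1.4–1.5 [Lawler1991].
-/

noncomputable section

namespace Literature.Probability.LatticeModels

open Finset

variable {d : ℕ}

/-! ### Adjacency-preserving bijections and the Laplacian -/

/-- The neighbours of `σ x` are the images of the neighbours of `x`, for an adjacency-preserving
bijection `σ`. [folklore] -/
theorem neighborFinset_equiv_eq_image {σ : Site d ≃ Site d}
    (hσ : ∀ x y, (zdGraph d).Adj (σ x) (σ y) ↔ (zdGraph d).Adj x y) (x : Site d) :
    (zdGraph d).neighborFinset (σ x) = ((zdGraph d).neighborFinset x).image σ := by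
  classical
  ext y
  simp only [SimpleGraph.mem_neighborFinset, Finset.mem_image]
  constructor
  · intro h
    refine ⟨σ.symm y, ?_, σ.apply_symm_apply y⟩
    have := (hσ x (σ.symm y)).1 (by rwa [σ.apply_symm_apply])
    exact this
  · rintro ⟨w, hw, rfl⟩
    exact (hσ x w).2 hw

/-- **`Δ (f ∘ σ) (x) = Δ f (σ x)`** for an adjacency-preserving bijection `σ` of `ℤ^d`. [folklore] -/
theorem latticeLaplacianZd_comp_equiv {σ : Site d ≃ Site d}
    (hσ : ∀ x y, (zdGraph d).Adj (σ x) (σ y) ↔ (zdGraph d).Adj x y) (f : Site d → ℝ) (x : Site d) :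
    latticeLaplacianZd (f ∘ σ) x = latticeLaplacianZd f (σ x) := by
  classical
  rw [latticeLaplacianZd_eq_sum_neighborFinset, latticeLaplacianZd_eq_sum_neighborFinset,
    neighborFinset_equiv_eq_image hσ x, Finset.sum_image fun a _ b _ h => σ.injective h]
  rfl

/-! ### The Dirichlet Green function -/

/-- Membership in the image set. [folklore] -/
theorem mem_map_equiv_iff (σ : Site d ≃ Site d) (Λ : Finset (Site d)) (y : Site d) :
    σ y ∈ Λ.map σ.toEmbedding ↔ y ∈ Λ := by
  rw [Finset.mem_map_equiv, Equiv.symm_apply_apply]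

/-- **`G_{σΛ}(σx, σy) = G_Λ(x, y)`**: the Dirichlet Green function is invariant under every
adjacency-preserving bijection of `ℤ^d` (`d ≥ 1`). Both sides vanish off `Λ` and solve
`-Δ_y u = δ_x` on `Λ`; uniqueness for the discrete Dirichlet problem. [folklore] -/
theorem dirichletGreen_map_equiv (hd : 0 < d) {σ : Site d ≃ Site d}
    (hσ : ∀ x y, (zdGraph d).Adj (σ x) (σ y) ↔ (zdGraph d).Adj x y) (Λ : Finset (Site d))
    (x y : Site d) :
    dirichletGreen (Λ.map σ.toEmbedding) (σ x) (σ y) = dirichletGreen Λ x y := by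
  classical
  set Λ' := Λ.map σ.toEmbedding with hΛ'
  by_cases hx : x ∈ Λ
  · -- `u = G_{Λ'}(σx, σ ·)` and `v = G_Λ(x, ·)` solve the same Poisson problem
    set u : Site d → ℝ := fun w => dirichletGreen Λ' (σ x) (σ w) with hu
    have hu_off : ∀ w ∉ Λ, u w = 0 := fun w hw => by
      simp only [hu]
      exact dirichletGreen_of_not_mem_right Λ' (σ x) (by rwa [hΛ', mem_map_equiv_iff])
    have hv_off : ∀ w ∉ Λ, dirichletGreen Λ x w = 0 := fun w hw =>
      dirichletGreen_of_not_mem_right Λ x hw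
    have hlap_u : ∀ w ∈ Λ, -latticeLaplacianZd u w = if x = w then 1 else 0 := by
      intro w hw
      have hcomp : u = (dirichletGreen Λ' (σ x)) ∘ σ := rfl
      rw [hcomp, latticeLaplacianZd_comp_equiv hσ,
        neg_latticeLaplacianZd_dirichletGreen hd Λ' (σ x) (by rwa [hΛ', mem_map_equiv_iff])]
      simp only [σ.injective.eq_iff]
    have hlap_v : ∀ w ∈ Λ, -latticeLaplacianZd (dirichletGreen Λ x) w = if x = w then 1 else 0 :=
      fun w hw => neg_latticeLaplacianZd_dirichletGreen hd Λ x hw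
    -- the difference is harmonic on `Λ` and vanishes outside
    have hharm : IsZdHarmonicOn (fun w => u w - dirichletGreen Λ x w) (↑Λ : Set (Site d)) := by
      intro w hw
      have h1 := hlap_u w hw
      have h2 := hlap_v w hw
      have : latticeLaplacianZd (fun w => u w - dirichletGreen Λ x w) w =
          latticeLaplacianZd u w - latticeLaplacianZd (dirichletGreen Λ x) w :=
        latticeLaplacianZd_sub u (dirichletGreen Λ x) w
      rw [this]
      linarith
    have hzero : IsZdHarmonicOn (fun _ : Site d => (0 : ℝ)) (↑Λ : Set (Site d)) :=
      fun w _ => latticeLaplacianZd_const 0 w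
    have hb : ∀ w ∈ zdOuterBoundary (↑Λ : Set (Site d)),
        (fun w => u w - dirichletGreen Λ x w) w = (fun _ : Site d => (0 : ℝ)) w := by
      intro w hw
      have hw' : w ∉ Λ := fun h => hw.1 h
      simp only [hu_off w hw', hv_off w hw', sub_zero]
    by_cases hy : y ∈ Λ
    · have key := hharm.eq_of_eq_boundary hd Λ.finite_toSet hzero hb hy
      simp only at key
      linarith
    · rw [hv_off y hy]
      exact hu_off y hy
  · rw [dirichletGreen_of_not_mem_left Λ hx,
      dirichletGreen_of_not_mem_left _ (by rwa [mem_map_equiv_iff])]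

/-- **`H_{σΛ}(σx, σz) = H_Λ(x, z)`**: the Poisson kernel is invariant under every
adjacency-preserving bijection of `ℤ^d` (`d ≥ 1`). [folklore] -/
theorem poissonKernel_map_equiv (hd : 0 < d) {σ : Site d ≃ Site d}
    (hσ : ∀ x y, (zdGraph d).Adj (σ x) (σ y) ↔ (zdGraph d).Adj x y) (Λ : Finset (Site d))
    (x z : Site d) :
    poissonKernel (Λ.map σ.toEmbedding) (σ x) (σ z) = poissonKernel Λ x z := by
  classical
  unfold poissonKernel
  by_cases hz : z ∈ Λ
  · rw [if_pos ((mem_map_equiv_iff σ Λ z).2 hz), if_pos hz]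
  · rw [if_neg (mt (mem_map_equiv_iff σ Λ z).1 hz), if_neg hz, neighborFinset_equiv_eq_image hσ z,
      Finset.sum_image fun a _ b _ h => σ.injective h]
    exact Finset.sum_congr rfl fun w _ => dirichletGreen_map_equiv hd hσ Λ x w

/-- The outer boundary of `σΛ` is the image of the outer boundary of `Λ`. [folklore] -/
theorem outerBoundary_map_equiv {σ : Site d ≃ Site d}
    (hσ : ∀ x y, (zdGraph d).Adj (σ x) (σ y) ↔ (zdGraph d).Adj x y) (Λ : Finset (Site d)) :
    outerBoundary (zdGraph d) (Λ.map σ.toEmbedding) = (outerBoundary (zdGraph d) Λ).map σ.toEmbedding := by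
  classical
  ext w
  rw [Finset.mem_map_equiv, mem_outerBoundary_iff, mem_outerBoundary_iff, Finset.mem_map_equiv]
  constructor
  · rintro ⟨hw, y, hy, hadj⟩
    refine ⟨hw, σ.symm y, ?_, ?_⟩
    · rwa [Finset.mem_map_equiv] at hy
    · rw [← hσ, σ.apply_symm_apply, σ.apply_symm_apply]; exact hadj
  · rintro ⟨hw, y, hy, hadj⟩
    refine ⟨hw, σ y, (mem_map_equiv_iff σ Λ y).2 hy, ?_⟩
    have := (hσ (σ.symm w) y).2 hadj
    rwa [σ.apply_symm_apply] at this

/-- Sums over the outer boundary transform accordingly. [folklore] -/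
theorem sum_outerBoundary_map_equiv {σ : Site d ≃ Site d}
    (hσ : ∀ x y, (zdGraph d).Adj (σ x) (σ y) ↔ (zdGraph d).Adj x y) (Λ : Finset (Site d))
    (F : Site d → ℝ) :
    ∑ w ∈ outerBoundary (zdGraph d) (Λ.map σ.toEmbedding), F w =
      ∑ z ∈ outerBoundary (zdGraph d) Λ, F (σ z) := by
  rw [outerBoundary_map_equiv hσ, Finset.sum_map]
  rfl

/-! ### The symmetries of `ℤ²` and of `ℤ^d` used downstream -/

/-- **Translation invariance of the Dirichlet Green function**: `G_{Λ+v}(x+v, y+v) = G_Λ(x, y)`.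
[cite: Lawler1991, §1.5] -/
theorem dirichletGreen_shift (hd : 0 < d) (Λ : Finset (Site d)) (v x y : Site d) :
    dirichletGreen (Λ.map (Site.shift v).toEmbedding) (x + v) (y + v) = dirichletGreen Λ x y :=
  dirichletGreen_map_equiv hd (zdGraph_adj_shift_iff v) Λ x y

/-- **Translation invariance of the Poisson kernel**: `H_{Λ+v}(x+v, z+v) = H_Λ(x, z)`.
[cite: Lawler1991, §1.4] -/
theorem poissonKernel_shift (hd : 0 < d) (Λ : Finset (Site d)) (v x z : Site d) :
    poissonKernel (Λ.map (Site.shift v).toEmbedding) (x + v) (z + v) = poissonKernel Λ x z :=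
  poissonKernel_map_equiv hd (zdGraph_adj_shift_iff v) Λ x z

/-- The reflection `(a, b) ↦ (-a, b)` of `ℤ²`. [folklore] -/
def reflectFst : Site 2 ≃ Site 2 where
  toFun x := ![-x 0, x 1]
  invFun x := ![-x 0, x 1]
  left_inv x := by ext i; fin_cases i <;> simp
  right_inv x := by ext i; fin_cases i <;> simp

/-- The reflection `(a, b) ↦ (a, -b)` of `ℤ²`. [folklore] -/
def reflectSnd : Site 2 ≃ Site 2 where
  toFun x := ![x 0, -x 1]
  invFun x := ![x 0, -x 1]
  left_inv x := by ext i; fin_cases i <;> simp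
  right_inv x := by ext i; fin_cases i <;> simp

/-- The coordinate swap `(a, b) ↦ (b, a)` of `ℤ²`. [folklore] -/
def swapCoords : Site 2 ≃ Site 2 where
  toFun x := ![x 1, x 0]
  invFun x := ![x 1, x 0]
  left_inv x := by ext i; fin_cases i <;> simp
  right_inv x := by ext i; fin_cases i <;> simp

/-- First coordinate of `reflectFst x`. [folklore] -/
@[simp] theorem reflectFst_apply_zero (x : Site 2) : reflectFst x 0 = -x 0 := rfl
/-- Second coordinate of `reflectFst x`. [folklore] -/
@[simp] theorem reflectFst_apply_one (x : Site 2) : reflectFst x 1 = x 1 := rfl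
/-- First coordinate of `reflectSnd x`. [folklore] -/
@[simp] theorem reflectSnd_apply_zero (x : Site 2) : reflectSnd x 0 = x 0 := rfl
/-- Second coordinate of `reflectSnd x`. [folklore] -/
@[simp] theorem reflectSnd_apply_one (x : Site 2) : reflectSnd x 1 = -x 1 := rfl
/-- First coordinate of `swapCoords x`. [folklore] -/
@[simp] theorem swapCoords_apply_zero (x : Site 2) : swapCoords x 0 = x 1 := rfl
/-- Second coordinate of `swapCoords x`. [folklore] -/
@[simp] theorem swapCoords_apply_one (x : Site 2) : swapCoords x 1 = x 0 := rfl

/-- Adjacency in `ℤ²` in coordinates: the two sites differ by `±1` in exactly one coordinate.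
[folklore] -/
theorem adj_two_iff (x y : Site 2) :
    (zdGraph 2).Adj x y ↔
      (y 0 = x 0 + 1 ∧ y 1 = x 1) ∨ (y 0 = x 0 - 1 ∧ y 1 = x 1) ∨
        (y 0 = x 0 ∧ y 1 = x 1 + 1) ∨ (y 0 = x 0 ∧ y 1 = x 1 - 1) := by
  rw [zdGraph_adj_iff]
  constructor
  · rintro ⟨i, h | h⟩
    · fin_cases i
      · left; exact ⟨by simp [h], by simp [h]⟩
      · right; right; left; exact ⟨by simp [h], by simp [h]⟩
    · fin_cases i
      · right; left; exact ⟨by simp [h], by simp [h]⟩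
      · right; right; right; exact ⟨by simp [h], by simp [h]⟩
  · rintro (⟨h0, h1⟩ | ⟨h0, h1⟩ | ⟨h0, h1⟩ | ⟨h0, h1⟩)
    · exact ⟨0, Or.inl (by ext i; fin_cases i <;> simp [h0, h1])⟩
    · exact ⟨0, Or.inr (by ext i; fin_cases i <;> simp [h0, h1])⟩
    · exact ⟨1, Or.inl (by ext i; fin_cases i <;> simp [h0, h1])⟩
    · exact ⟨1, Or.inr (by ext i; fin_cases i <;> simp [h0, h1])⟩

/-- `reflectFst` preserves adjacency. [folklore] -/
theorem adj_reflectFst_iff (x y : Site 2) :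
    (zdGraph 2).Adj (reflectFst x) (reflectFst y) ↔ (zdGraph 2).Adj x y := by
  simp only [adj_two_iff, reflectFst_apply_zero, reflectFst_apply_one]
  omega

/-- `reflectSnd` preserves adjacency. [folklore] -/
theorem adj_reflectSnd_iff (x y : Site 2) :
    (zdGraph 2).Adj (reflectSnd x) (reflectSnd y) ↔ (zdGraph 2).Adj x y := by
  simp only [adj_two_iff, reflectSnd_apply_zero, reflectSnd_apply_one]
  omega

/-- `swapCoords` preserves adjacency. [folklore] -/
theorem adj_swapCoords_iff (x y : Site 2) :
    (zdGraph 2).Adj (swapCoords x) (swapCoords y) ↔ (zdGraph 2).Adj x y := by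
  simp only [adj_two_iff, swapCoords_apply_zero, swapCoords_apply_one]
  omega

end Literature.Probability.LatticeModels

end
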